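import Summits.Ventures.Crystal3D.Theorems.StickyWulffConstantGenericWallFloorDoubleTopLocalAtlasA
import Summits.Ventures.Crystal3D.Theorems.StickyWulffConstantGenericWallFloorDoubleTopLocalAtlasB
import HarnessLib

/-!
# Double tops: the degree lemma modulo the interval certificate — `DoubleTopFar` and the assembly
# (crux `GenericWallFloor`, line `WallLedgerG`, residual `#DT₁₁`; R39d «DoubleStarFree»)

HONEST FRAMING. Part of the venture `Summits/Ventures/Crystal3D` (cell `crystal3d-full`), helper
`--supports` the crux `GenericWallFloor` (stmt-Ventures-19480) of `route-Ventures-StickyWulffConstant`,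
registered line `WallLedgerG`, open stub `stub_twoSlabAdhesion`.  cf-p1 ROUTE §82(3)/(7): the chain ledger
(`twoSlabAdhesion_chainLedger'`) needs «a double top of a NON-co-axial pair has degree ≤ 10».  In the
normal form of `…DoubleTopLocalFrame` (relative rotation `R`, walk cluster `wPt` of `slotSite 0`, eleventh
ball `y`) the statement is: the two predecessor dozens `wPt`, `R·wPt` `1`-separated up to coincidence and a
unit `y` at distance `≥ 1` from their `24` non-centre balls ⇒ `(Λ₀, R·Λ₀)` co-axial.  This file splits it:

* the LOCAL half is in the tree: the `46` certificate balls of `…DoubleTopLocalAtlasA/B` (`dtCerts`);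
* **`DoubleTopFar`** — the GLOBAL half as a named computational hypothesis (R39d, interval branch and
  bound over `SO(3)`, eng/cf-p2): outside all certificate balls — tested for `R` AND for `R ∘ μ`, `μ` the
  bond mirror of `slotSite 1` (it fixes the walk cluster, `swapMirror_wPt`, so an improper `R` is covered
  by the proper `R ∘ μ`) — no such configuration exists.  Margins there are positive (seat numerics:
  free-ball slack `≥ 0.23·dist` to the critical rotations, cluster overlap `≥ 0.42` at the `80` infeasible
  co-axial rotations), so this is certificate territory, unlike the balls;
* **`coaxial_of_doubleTop`** — `DoubleTopFar` ⇒ the full statement (case split: in a ball of `R` ⇒ atlas;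
  in a ball of `R ∘ μ` ⇒ atlas for `R ∘ μ`, and `(R ∘ μ)·Λ₀ = R·Λ₀`; else `DoubleTopFar`).

WHAT THIS IS NOT: `DoubleTopFar` is NOT proved here (certified computation to come, R39d); the ledger
glue (slot normalisation `u₁, u₂ ↦ slotSite 0`, translation by the top `e`, `deg e ≤ 10`) is the next
file; rung F-C1 not moved.
-/

noncomputable section

namespace Summit.Ventures.Crystal3D.Theorems

open Matrix NearIdentity
open Literature.MathematicalPhysics.StatisticalMechanics (fccStacking barlowStacking)

/-! ### The certificate list and the balls -/

/-- The `46` local rigidity certificates of `…DoubleTopLocalData1–4`. -/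
def dtCerts : List DTCert :=
  [cert_b0, cert_b1, cert_b2, cert_b3_m1p1p0, cert_b3_p1m1p0, cert_b4, cert_b5, cert_b6, cert_b7,
    cert_b8, cert_b9, cert_b10, cert_b11_m1p1p0, cert_b11_p1m1p0, cert_b12, cert_b13, cert_b14,
    cert_b15, cert_b16, cert_b17, cert_b18, cert_b19, cert_b20, cert_b21, cert_b22, cert_b23,
    cert_b27, cert_b31_p1p0m1, cert_b31_p1m1p0, cert_b35, cert_b38_p1p0m1, cert_b38_p1m1p0,
    cert_b41_p0p1m1, cert_b41_m1p1p0, cert_b47_p0p1m1, cert_b47_m1p1p0, cert_b51, cert_b54_p1p0p1,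
    cert_b54_p1m1p0, cert_b59, cert_b63_p1p0p1, cert_b63_p1m1p0, cert_b67_p0p1p1, cert_b67_m1p1p0,
    cert_b69_p0p1p1, cert_b69_m1p1p0]

/-- `(R, y)` lies in the ball of the certificate `c`. -/
def InCertBall (R : EuclideanSpace ℝ (Fin 3) ≃ₗᵢ[ℝ] EuclideanSpace ℝ (Fin 3)) (y : EuclideanSpace ℝ (Fin 3))
    (c : DTCert) : Prop :=
  frob (cubicMat R * c.bRᵀ - 1) + (if c.useY then 2 * ‖y - c.y0E‖ ^ 2 else 0) < 1 / c.Ktot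

/-- **Atlas dispatch**: inside the ball of any listed certificate the pair is co-axial. -/
theorem coaxial_of_inCertBall (R : EuclideanSpace ℝ (Fin 3) ≃ₗᵢ[ℝ] EuclideanSpace ℝ (Fin 3))
    (y : EuclideanSpace ℝ (Fin 3)) (hclus : ∀ i j : Fin 13, wPt i = R (wPt j) ∨ 1 ≤ dist (wPt i) (R (wPt j)))
    (hy : ‖y‖ = 1) (hyF : ∀ i, clusterQ i ≠ 0 → 1 ≤ dist y (wPt i))
    (hyM : ∀ j, clusterQ j ≠ 0 → 1 ≤ dist y (R (wPt j)))
    {c : DTCert} (hc : c ∈ dtCerts) (hb : InCertBall R y c) :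
    ∃ L : EuclideanSpace ℝ (Fin 3) ≃ₗᵢ[ℝ] EuclideanSpace ℝ (Fin 3),
      (fccStacking 1 (Real.sqrt (2 / 3)) = L '' fccStacking 1 (Real.sqrt (2 / 3)) ∨
        fccStacking 1 (Real.sqrt (2 / 3)) = L '' barlowStacking 1 (Real.sqrt (2 / 3)) (fun _ : ℤ => (-1 : ℤ))) ∧
      (R '' fccStacking 1 (Real.sqrt (2 / 3)) = L '' fccStacking 1 (Real.sqrt (2 / 3)) ∨
        R '' fccStacking 1 (Real.sqrt (2 / 3)) = L '' barlowStacking 1 (Real.sqrt (2 / 3)) (fun _ : ℤ => (-1 : ℤ))) := by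
  unfold InCertBall at hb
  simp only [dtCerts, List.mem_cons, List.mem_nil_iff, or_false] at hc
  rcases hc with rfl | rfl | rfl | rfl | rfl | rfl | rfl | rfl | rfl | rfl | rfl | rfl | rfl | rfl | rfl | rfl | rfl | rfl | rfl | rfl | rfl | rfl | rfl | rfl | rfl | rfl | rfl | rfl | rfl | rfl | rfl | rfl | rfl | rfl | rfl | rfl | rfl | rfl | rfl | rfl | rfl | rfl | rfl | rfl | rfl | rfl
  · exact cert_b0_coaxial R y hclus hy hyF hyM hb
  · exact cert_b1_coaxial R y hclus hy hyF hyM hb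
  · exact cert_b2_coaxial R y hclus hy hyF hyM hb
  · exact cert_b3_m1p1p0_coaxial R y hclus hy hyF hyM hb
  · exact cert_b3_p1m1p0_coaxial R y hclus hy hyF hyM hb
  · exact cert_b4_coaxial R y hclus hy hyF hyM hb
  · exact cert_b5_coaxial R y hclus hy hyF hyM hb
  · exact cert_b6_coaxial R y hclus hy hyF hyM hb
  · exact cert_b7_coaxial R y hclus hy hyF hyM hb
  · exact cert_b8_coaxial R y hclus hy hyF hyM hb
  · exact cert_b9_coaxial R y hclus hy hyF hyM hb
  · exact cert_b10_coaxial R y hclus hy hyF hyM hb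
  · exact cert_b11_m1p1p0_coaxial R y hclus hy hyF hyM hb
  · exact cert_b11_p1m1p0_coaxial R y hclus hy hyF hyM hb
  · exact cert_b12_coaxial R y hclus hy hyF hyM hb
  · exact cert_b13_coaxial R y hclus hy hyF hyM hb
  · exact cert_b14_coaxial R y hclus hy hyF hyM hb
  · exact cert_b15_coaxial R y hclus hy hyF hyM hb
  · exact cert_b16_coaxial R y hclus hy hyF hyM hb
  · exact cert_b17_coaxial R y hclus hy hyF hyM hb
  · exact cert_b18_coaxial R y hclus hy hyF hyM hb
  · exact cert_b19_coaxial R y hclus hy hyF hyM hb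
  · exact cert_b20_coaxial R y hclus hy hyF hyM hb
  · exact cert_b21_coaxial R y hclus hy hyF hyM hb
  · exact cert_b22_coaxial R y hclus hy hyF hyM hb
  · exact cert_b23_coaxial R y hclus hy hyF hyM hb
  · exact cert_b27_coaxial R y hclus hy hyF hyM hb
  · exact cert_b31_p1p0m1_coaxial R y hclus hy hyF hyM hb
  · exact cert_b31_p1m1p0_coaxial R y hclus hy hyF hyM hb
  · exact cert_b35_coaxial R y hclus hy hyF hyM hb
  · exact cert_b38_p1p0m1_coaxial R y hclus hy hyF hyM hb
  · exact cert_b38_p1m1p0_coaxial R y hclus hy hyF hyM hb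
  · exact cert_b41_p0p1m1_coaxial R y hclus hy hyF hyM hb
  · exact cert_b41_m1p1p0_coaxial R y hclus hy hyF hyM hb
  · exact cert_b47_p0p1m1_coaxial R y hclus hy hyF hyM hb
  · exact cert_b47_m1p1p0_coaxial R y hclus hy hyF hyM hb
  · exact cert_b51_coaxial R y hclus hy hyF hyM hb
  · exact cert_b54_p1p0p1_coaxial R y hclus hy hyF hyM hb
  · exact cert_b54_p1m1p0_coaxial R y hclus hy hyF hyM hb
  · exact cert_b59_coaxial R y hclus hy hyF hyM hb
  · exact cert_b63_p1p0p1_coaxial R y hclus hy hyF hyM hb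
  · exact cert_b63_p1m1p0_coaxial R y hclus hy hyF hyM hb
  · exact cert_b67_p0p1p1_coaxial R y hclus hy hyF hyM hb
  · exact cert_b67_m1p1p0_coaxial R y hclus hy hyF hyM hb
  · exact cert_b69_p0p1p1_coaxial R y hclus hy hyF hyM hb
  · exact cert_b69_m1p1p0_coaxial R y hclus hy hyF hyM hb

/-! ### The mirror fixing the walk cluster -/

/-- The bond mirror of `slotSite 1` (cubic vector `(1,−1,0)`): it swaps the first two cubic coordinates,
fixes `slotSite 0 = (1,1,0)/√2` and permutes the walk cluster. -/
def swapMirror : EuclideanSpace ℝ (Fin 3) ≃ₗᵢ[ℝ] EuclideanSpace ℝ (Fin 3) := (ℝ ∙ slotSite 1)ᗮ.reflection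

/-- The permutation of the walk cluster induced by `swapMirror`. -/
def swapPerm : Fin 13 → Fin 13 := ![0, 1, 3, 2, 4, 9, 10, 11, 12, 5, 6, 7, 8]

/-- Table check: the mirror matrix permutes the cluster as `swapPerm`, which preserves non-centre balls. -/
theorem swapPerm_facts :
    (∀ j : Fin 13, DTCert.mulQ (mirrorQ 1) (clusterQ j) = clusterQ (swapPerm j)) ∧
    (∀ j : Fin 13, clusterQ j ≠ 0 → clusterQ (swapPerm j) ≠ 0) := by
  decide +kernel

/-- `swapMirror (wPt j) = wPt (swapPerm j)`. -/
theorem swapMirror_wPt (j : Fin 13) : swapMirror (wPt j) = wPt (swapPerm j) := by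
  have hs0 : Real.sqrt 2 ≠ 0 := by positivity
  apply cubicCoords_injective
  have h1 : Real.sqrt 2 • cubicCoords (swapMirror (wPt j)) = Real.sqrt 2 • cubicCoords (wPt (swapPerm j)) := by
    rw [cubicCoords_eq_cubicMat_mulVec, swapMirror, cubicMat_bondReflection, ← Matrix.mulVec_smul,
      sqrt_two_smul_cubicCoords_wPt, sqrt_two_smul_cubicCoords_wPt]
    have := swapPerm_facts.1 j
    ext i
    have hi := congrFun this i
    simp only [Matrix.mulVec, dotProduct, Fin.sum_univ_three, castMat, Matrix.of_apply, fR, castVec,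
      DTCert.mulQ] at hi ⊢
    rw [← hi]; push_cast; ring
  have := congrArg (fun v => (Real.sqrt 2)⁻¹ • v) h1
  simpa [smul_smul, inv_mul_cancel₀ hs0] using this

/-- `swapMirror` preserves `Λ₀`. -/
theorem swapMirror_image_fcc :
    swapMirror '' fccStacking 1 (Real.sqrt (2 / 3)) = fccStacking 1 (Real.sqrt (2 / 3)) := by
  have h := latticeIsometry_bondReflection (mem_fcc_of_mem_fccSlots (slotSite_mem 1))
    (norm_eq_one_of_mem_fccSlots (slotSite_mem 1))
  apply Set.Subset.antisymm
  · rintro _ ⟨p, hp, rfl⟩; exact h.1 p hp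
  · intro p hp; exact ⟨swapMirror.symm p, h.2 p hp, swapMirror.apply_symm_apply p⟩

/-! ### The global half as a named hypothesis, and the assembly -/

/-- **`DoubleTopFar` (R39d, global half; certified computation, NOT proved here).**  For every linear
isometry `R` and point `y`: if the walk cluster and its `R`-image are `1`-separated up to coincidence,
`y` is a unit vector at distance `≥ 1` from the `24` non-centre balls, and `(R, y)` as well as
`(R ∘ μ, y)` lie OUTSIDE every certificate ball of `dtCerts`, then `False`. -/
def DoubleTopFar : Prop :=
  ∀ (R : EuclideanSpace ℝ (Fin 3) ≃ₗᵢ[ℝ] EuclideanSpace ℝ (Fin 3)) (y : EuclideanSpace ℝ (Fin 3)),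
    (∀ i j : Fin 13, wPt i = R (wPt j) ∨ 1 ≤ dist (wPt i) (R (wPt j))) →
    ‖y‖ = 1 → (∀ i, clusterQ i ≠ 0 → 1 ≤ dist y (wPt i)) → (∀ j, clusterQ j ≠ 0 → 1 ≤ dist y (R (wPt j))) →
    (∀ c ∈ dtCerts, ¬ InCertBall R y c) → (∀ c ∈ dtCerts, ¬ InCertBall (swapMirror.trans R) y c) → False

/-- **DoubleTopDegree, normal form.**  Under `DoubleTopFar`: two predecessor dozens `wPt`, `R·wPt`
`1`-separated up to coincidence and an eleventh unit ball `y` clear of their `24` non-centre balls force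
`(Λ₀, R·Λ₀)` to be co-axial. -/
theorem coaxial_of_doubleTop (hfar : DoubleTopFar)
    (R : EuclideanSpace ℝ (Fin 3) ≃ₗᵢ[ℝ] EuclideanSpace ℝ (Fin 3)) (y : EuclideanSpace ℝ (Fin 3))
    (hclus : ∀ i j : Fin 13, wPt i = R (wPt j) ∨ 1 ≤ dist (wPt i) (R (wPt j)))
    (hy : ‖y‖ = 1) (hyF : ∀ i, clusterQ i ≠ 0 → 1 ≤ dist y (wPt i))
    (hyM : ∀ j, clusterQ j ≠ 0 → 1 ≤ dist y (R (wPt j))) :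
    ∃ L : EuclideanSpace ℝ (Fin 3) ≃ₗᵢ[ℝ] EuclideanSpace ℝ (Fin 3),
      (fccStacking 1 (Real.sqrt (2 / 3)) = L '' fccStacking 1 (Real.sqrt (2 / 3)) ∨
        fccStacking 1 (Real.sqrt (2 / 3)) = L '' barlowStacking 1 (Real.sqrt (2 / 3)) (fun _ : ℤ => (-1 : ℤ))) ∧
      (R '' fccStacking 1 (Real.sqrt (2 / 3)) = L '' fccStacking 1 (Real.sqrt (2 / 3)) ∨
        R '' fccStacking 1 (Real.sqrt (2 / 3)) = L '' barlowStacking 1 (Real.sqrt (2 / 3)) (fun _ : ℤ => (-1 : ℤ))) := by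
  classical
  by_cases h1 : ∃ c ∈ dtCerts, InCertBall R y c
  · obtain ⟨c, hc, hb⟩ := h1
    exact coaxial_of_inCertBall R y hclus hy hyF hyM hc hb
  set R' := swapMirror.trans R with hR'
  have hR'app : ∀ x, R' x = R (swapMirror x) := fun x => rfl
  by_cases h2 : ∃ c ∈ dtCerts, InCertBall R' y c
  · obtain ⟨c, hc, hb⟩ := h2
    have hclus' : ∀ i j : Fin 13, wPt i = R' (wPt j) ∨ 1 ≤ dist (wPt i) (R' (wPt j)) := by
      intro i j; rw [hR'app, swapMirror_wPt]; exact hclus i (swapPerm j)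
    have hyM' : ∀ j, clusterQ j ≠ 0 → 1 ≤ dist y (R' (wPt j)) := by
      intro j hj; rw [hR'app, swapMirror_wPt]; exact hyM _ (swapPerm_facts.2 j hj)
    obtain ⟨L, hL1, hL2⟩ := coaxial_of_inCertBall R' y hclus' hy hyF hyM' hc hb
    have himg : R' '' fccStacking 1 (Real.sqrt (2 / 3)) = R '' fccStacking 1 (Real.sqrt (2 / 3)) := by
      rw [hR', LinearIsometryEquiv.coe_trans, Set.image_comp, swapMirror_image_fcc]
    exact ⟨L, hL1, by rw [← himg]; exact hL2⟩
  · push Not at h1 h2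
    exact (hfar R y hclus hy hyF hyM h1 h2).elim

end Summit.Ventures.Crystal3D.Theorems

end
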